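import Mathlib
import HarnessLib
import Summits.Ventures.LatticeQCDFlow.Exactness.U1LeapfrogEnergyError
import Summits.Ventures.LatticeQCDFlow.Exactness.U1MomentumLawMoments

/-!
# `U(1)` rung — THE MEAN ACCEPTANCE OF THE ENGINE'S `n`-STEP LEAPFROG PROPOSAL IS AT LEAST `1 − O(nε²)`, EXPLICITLY: the pointwise energy-error law of `U1LeapfrogEnergyError` averaged over the Gaussian momentum refresh, from every configuration

HONEST FRAMING: exact (Metropolis-corrected) sampling algorithms for lattice gauge theory;
figures of merit are autocorrelation/cost numbers at stated couplings and volumes; no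
continuum-physics claim.

Venture `LatticeQCDFlow` (cell pub-lqcd), topic `Exactness`; FANOUT row 14 (`eng-flowhmc`, engine
`latflow.fthmc`, family B, `U(1)` rung; the row's test battery reports the MEAN Metropolis acceptance).  The `U(1)`
twin of `SU2LeapfrogMeanAcceptance`.  NEW WORK of the cell over the tree: `U1LeapfrogEnergyError`
(`abs_u1LeapfrogProposalN_energy_error_le`: for ANY action `S` whose angular derivative
`D_e(W) = ∂_{θ_e} S(e^{iεθ}·W)|₀` is bounded by `D_max` and `K`-Lipschitz in the sup metric, the energy error of the
engine's proposal `u1LeapfrogProposalN ε g n` with the consistent half kick `g = −D/(4κ)` is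
`≤ n·K(‖p‖ + b)|ε|(Σ_e|p_e| + c₁ + c₂)` pointwise, `b = (2n+1)D_max/(4κ)`, `c₁ = (2n+1)|E|D_max/(4κ)`,
`c₂ = |E|D_max/(8κ)`), `U1MomentumLawMoments` (`E Σ_e|p_e| = |E|/√(πκ)`, `E (Σ_e|p_e|)² ≤ |E|²/(2κ)` under
`u1MomentumLaw κ`), row 9's `U1MultiStepLeapfrogHMC` (`u1LeapfrogProposalN`, `measurable_u1LeapfrogProposalN`); nothing
is cited as a fact; no number.

* `u1Momentum_pi_norm_le_sum_abs` (`‖p‖_∞ ≤ Σ_e|p_e|`; the elementary `1 − |x| ≤ min(1, e^{−x})` is used inline);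
* **`u1LeapfrogProposalN_meanAcceptance_ge`** — for ANY measurable action with `θ ↦ S(e^{iεθ}·W)` differentiable at
  `0`, a MEASURABLE angular derivative `D` with the two bounds, `κ > 0`, consistent half kick: from EVERY configuration
  `q`, `∫ min(1, e^{−ΔH(q,p)}) d(u1MomentumLaw κ)(p) ≥ 1 − n·K|ε|·(|E|²/(2κ) + (b + c₁ + c₂)·|E|/√(πκ) + b(c₁ + c₂))`
  — `1 − O(nε²)` once `K, D_max = O(ε)`, which `U1WilsonFlowLOExactForceLipschitz` delivers EXPLICITLY for the LO
  member (`D = g|_{c = ε, κ = 1}`: `D_max = (1+A)^n(2(d−1)|β||ε| + n·u)`, …) — uniform in `q`, hence in equilibrium.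

NOT CLAIMED: the Gaussian/erfc model of `ΔH`; optimal constants; the explicit LO instantiation (a sequel that
composes this file with `U1WilsonFlowLOExactForceLipschitz`); floating point; any number.
-/

noncomputable section

namespace Summit.Ventures.LatticeQCDFlow.Exactness

open Set Function MeasureTheory
open Literature.MathematicalPhysics.QuantumFieldTheory Literature.MathematicalPhysics.QuantumLattice
open scoped ENNReal

section MeanAcceptance

variable {d L : ℕ} [NeZero L]

/-- The sup norm of the `U(1)` momenta is at most the sum of the link moduli. -/
theorem u1Momentum_pi_norm_le_sum_abs (p : Edge d L → ℝ) : ‖p‖ ≤ ∑ e, |p e| :=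
  (pi_norm_le_iff_of_nonneg (Finset.sum_nonneg fun e _ => abs_nonneg (p e))).2 fun e => by
    rw [Real.norm_eq_abs]; exact Finset.single_le_sum (fun m _ => abs_nonneg (p m)) (Finset.mem_univ e)

/-- **THE MEAN ACCEPTANCE OF THE ENGINE'S `n`-STEP `U(1)` PROPOSAL IS AT LEAST `1 − O(nε²)`, EXPLICITLY.**  For ANY
measurable action `S` with `θ ↦ S(e^{iεθ}·W)` differentiable at `0`, a measurable angular derivative
`D_e(W) = ∂_{θ_e} S(e^{iεθ}·W)|₀` with `|D| ≤ D_max`, `|D_e(W) − D_e(W')| ≤ K·dist(W, W')`, kinetic coefficient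
`κ > 0` and the consistent half kick `g = −D/(4κ)`: from EVERY configuration `q`,
`∫ min(1, e^{−ΔH(q,p)}) d(u1MomentumLaw κ)(p) ≥ 1 − n·K|ε|·(|E|²/(2κ) + (b + c₁ + c₂)·|E|/√(πκ) + b(c₁ + c₂))`,
`b = (2n+1)D_max/(4κ)`, `c₁ = (2n+1)|E|D_max/(4κ)`, `c₂ = |E|D_max/(8κ)`. -/
theorem u1LeapfrogProposalN_meanAcceptance_ge (S : GaugeConfig d L Circle → ℝ) (ε κ : ℝ) (hκ : 0 < κ)
    (hS : Measurable S)
    (hd : ∀ W : GaugeConfig d L Circle, DifferentiableAt ℝ (fun θ : (Edge d L → ℝ) => S ((fun i : Edge d L => Circle.exp (ε * θ i)) * W)) 0)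
    {Dmax K : ℝ} (hD0 : 0 ≤ Dmax) (hK0 : 0 ≤ K)
    (hDm : Measurable fun (W : GaugeConfig d L Circle) (e : Edge d L) =>
      fderiv ℝ (fun θ : (Edge d L → ℝ) => S ((fun i : Edge d L => Circle.exp (ε * θ i)) * W)) 0 (Pi.single e 1))
    (hDb : ∀ (W : GaugeConfig d L Circle) (e : Edge d L),
      |fderiv ℝ (fun θ : (Edge d L → ℝ) => S ((fun i : Edge d L => Circle.exp (ε * θ i)) * W)) 0 (Pi.single e 1)| ≤ Dmax)
    (hDK : ∀ (W W' : GaugeConfig d L Circle) (e : Edge d L),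
      |fderiv ℝ (fun θ : (Edge d L → ℝ) => S ((fun i : Edge d L => Circle.exp (ε * θ i)) * W)) 0 (Pi.single e 1) -
        fderiv ℝ (fun θ : (Edge d L → ℝ) => S ((fun i : Edge d L => Circle.exp (ε * θ i)) * W')) 0 (Pi.single e 1)| ≤ K * dist W W')
    (q : GaugeConfig d L Circle) (n : ℕ) :
    1 - n * (K * |ε|) *
        ((Fintype.card (Edge d L) : ℝ) ^ 2 * (1 / (2 * κ)) +
          ((2 * n + 1) * (Dmax / (4 * κ)) + (2 * n + 1) * (Fintype.card (Edge d L) * (Dmax / (4 * κ))) +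
              Fintype.card (Edge d L) * Dmax / (8 * κ)) * (Fintype.card (Edge d L) * (1 / Real.sqrt (Real.pi * κ))) +
          (2 * n + 1) * (Dmax / (4 * κ)) * ((2 * n + 1) * (Fintype.card (Edge d L) * (Dmax / (4 * κ))) + Fintype.card (Edge d L) * Dmax / (8 * κ))) ≤
      ∫ p, min 1 (Real.exp (-((S (u1LeapfrogProposalN ε (fun (W : GaugeConfig d L Circle) (e : Edge d L) => -(1 / (4 * κ)) * fderiv ℝ (fun θ : (Edge d L → ℝ) => S ((fun i : Edge d L => Circle.exp (ε * θ i)) * W)) 0 (Pi.single e 1)) n (q, p)).1 +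
          u1Kinetic κ (u1LeapfrogProposalN ε (fun (W : GaugeConfig d L Circle) (e : Edge d L) => -(1 / (4 * κ)) * fderiv ℝ (fun θ : (Edge d L → ℝ) => S ((fun i : Edge d L => Circle.exp (ε * θ i)) * W)) 0 (Pi.single e 1)) n (q, p)).2) -
        (S q + u1Kinetic κ p)))) ∂(u1MomentumLaw (ι := Edge d L) κ) := by
  haveI : Fact (0 < κ) := ⟨hκ⟩
  -- abbreviations
  set b : ℝ := (2 * n + 1) * (Dmax / (4 * κ)) with hb
  set c₁ : ℝ := (2 * n + 1) * (Fintype.card (Edge d L) * (Dmax / (4 * κ))) with hc₁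
  set c₂ : ℝ := Fintype.card (Edge d L) * Dmax / (8 * κ) with hc₂
  set α : ℝ := b + c₁ + c₂ with hα
  have hb0 : 0 ≤ b := by rw [hb]; positivity
  have hc₁0 : 0 ≤ c₁ := by rw [hc₁]; positivity
  have hc₂0 : 0 ≤ c₂ := by rw [hc₂]; positivity
  have hα0 : 0 ≤ α := by rw [hα]; positivity
  set G : GaugeConfig d L Circle → Edge d L → ℝ := fun W e =>
    -(1 / (4 * κ)) * fderiv ℝ (fun θ : (Edge d L → ℝ) => S ((fun i : Edge d L => Circle.exp (ε * θ i)) * W)) 0 (Pi.single e 1) with hG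
  set ΔH : (Edge d L → ℝ) → ℝ := fun p =>
    (S (u1LeapfrogProposalN ε G n (q, p)).1 + u1Kinetic κ (u1LeapfrogProposalN ε G n (q, p)).2) - (S q + u1Kinetic κ p) with hΔH
  -- the pointwise energy-error law, as a polynomial in Σ_e |p_e|
  have hpt : ∀ p : Edge d L → ℝ, |ΔH p| ≤ n * (K * |ε|) * ((∑ e, |p e|) ^ 2 + α * ∑ e, |p e| + b * (c₁ + c₂)) := by
    intro p
    have h := abs_u1LeapfrogProposalN_energy_error_le S ε κ hκ hd hD0 hK0 hDb hDK q p n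
    have hs := u1Momentum_pi_norm_le_sum_abs p
    have hs0 : 0 ≤ ∑ e, |p e| := Finset.sum_nonneg fun e _ => abs_nonneg _
    refine h.trans ?_
    rw [hα]
    have h1 : K * (‖p‖ + (2 * n + 1) * (Dmax / (4 * κ))) ≤ K * (∑ e, |p e| + b) := by
      rw [hb]; exact mul_le_mul_of_nonneg_left (by linarith) hK0
    have h2 : (0 : ℝ) ≤ (∑ e, |p e| + (2 * n + 1) * (Fintype.card (Edge d L) * (Dmax / (4 * κ)))) +
        Fintype.card (Edge d L) * Dmax / (8 * κ) := by positivity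
    calc (n : ℝ) * (K * (‖p‖ + (2 * n + 1) * (Dmax / (4 * κ))) * |ε| *
          ((∑ e, |p e| + (2 * n + 1) * (Fintype.card (Edge d L) * (Dmax / (4 * κ)))) + Fintype.card (Edge d L) * Dmax / (8 * κ)))
        ≤ n * (K * (∑ e, |p e| + b) * |ε| *
          ((∑ e, |p e| + (2 * n + 1) * (Fintype.card (Edge d L) * (Dmax / (4 * κ)))) + Fintype.card (Edge d L) * Dmax / (8 * κ))) := by
          gcongr
      _ = n * (K * |ε|) * ((∑ e, |p e|) ^ 2 + (b + c₁ + c₂) * ∑ e, |p e| + b * (c₁ + c₂)) := by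
          rw [hc₁, hc₂]; ring
  -- measurability of ΔH and integrability of both sides
  have hg : Measurable G := hDm.const_smul (-(1 / (4 * κ)))
  have hΨ : Measurable (⇑(u1LeapfrogProposalN ε G n)) := measurable_u1LeapfrogProposalN ε n hg
  have hΔm : Measurable ΔH := by
    rw [hΔH]
    have hq : Measurable fun p : Edge d L → ℝ => u1LeapfrogProposalN ε G n (q, p) := hΨ.comp measurable_prodMk_left
    exact ((hS.comp (measurable_fst.comp hq)).add ((measurable_u1Kinetic κ).comp (measurable_snd.comp hq))).sub
      (measurable_const.add (measurable_u1Kinetic κ))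
  have hacc_int : Integrable (fun p => min 1 (Real.exp (-ΔH p))) (u1MomentumLaw (ι := Edge d L) κ) := by
    refine (integrable_const (1 : ℝ)).mono' (measurable_const.min (hΔm.neg.exp)).aestronglyMeasurable
      (Filter.Eventually.of_forall fun p => ?_)
    rw [Real.norm_eq_abs, abs_of_nonneg (le_min zero_le_one (Real.exp_pos _).le)]
    exact min_le_left _ _
  have hint1 : Integrable (fun p : Edge d L → ℝ => ∑ e, |p e|) (u1MomentumLaw (ι := Edge d L) κ) :=
    integrable_finsetSum _ fun e _ => by
      simpa only [pow_one, Real.norm_eq_abs] using integrable_norm_apply_pow_u1MomentumLaw (ι := Edge d L) hκ 1 e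
  have hint2 : Integrable (fun p : Edge d L → ℝ => (∑ e, |p e|) ^ 2) (u1MomentumLaw (ι := Edge d L) κ) := by
    have hint2' : Integrable (fun p : Edge d L → ℝ => (Fintype.card (Edge d L) : ℝ) * ∑ e, |p e| ^ 2) (u1MomentumLaw (ι := Edge d L) κ) :=
      (integrable_finsetSum _ fun e _ => by
        simpa only [Real.norm_eq_abs] using integrable_norm_apply_pow_u1MomentumLaw (ι := Edge d L) hκ 2 e).const_mul _
    refine hint2'.mono' ((Finset.measurable_sum _ fun e _ => ((measurable_pi_apply e).norm)).pow_const 2).aestronglyMeasurable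
      (Filter.Eventually.of_forall fun p => ?_)
    rw [Real.norm_eq_abs, abs_of_nonneg (sq_nonneg _)]
    have h := sq_sum_le_card_mul_sum_sq (s := Finset.univ) (f := fun e => |p e|)
    simpa only [Finset.card_univ] using h
  have h8 : Integrable (fun p : Edge d L → ℝ => (∑ e, |p e|) ^ 2) (u1MomentumLaw (ι := Edge d L) κ) := hint2
  have hαs : Integrable (fun p : Edge d L → ℝ => α * ∑ e, |p e|) (u1MomentumLaw (ι := Edge d L) κ) := hint1.const_mul α
  have h8α : Integrable (fun p : Edge d L → ℝ => (∑ e, |p e|) ^ 2 + α * ∑ e, |p e|) (u1MomentumLaw (ι := Edge d L) κ) :=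
    h8.add hαs
  have hq3 : Integrable (fun p : Edge d L → ℝ => (∑ e, |p e|) ^ 2 + α * ∑ e, |p e| + b * (c₁ + c₂))
      (u1MomentumLaw (ι := Edge d L) κ) := h8α.add (integrable_const _)
  have hCq : Integrable (fun p : Edge d L → ℝ =>
      n * (K * |ε|) * ((∑ e, |p e|) ^ 2 + α * ∑ e, |p e| + b * (c₁ + c₂))) (u1MomentumLaw (ι := Edge d L) κ) :=
    hq3.const_mul _
  have hpoly_int : Integrable (fun p : Edge d L → ℝ =>
      1 - n * (K * |ε|) * ((∑ e, |p e|) ^ 2 + α * ∑ e, |p e| + b * (c₁ + c₂))) (u1MomentumLaw (ι := Edge d L) κ) :=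
    (integrable_const _).sub hCq
  -- `1 − |x| ≤ min(1, e^{−x})` (inline: the same elementary fact serves `SU2LeapfrogMeanAcceptance`)
  have hacc : ∀ x : ℝ, 1 - |x| ≤ min 1 (Real.exp (-x)) := by
    intro x
    rcases le_or_gt x 0 with hx | hx
    · rw [min_eq_left ((Real.one_le_exp_iff).2 (by linarith))]
      linarith [abs_nonneg x]
    · rw [abs_of_pos hx]
      refine le_min (by linarith) ?_
      linarith [Real.add_one_le_exp (-x)]
  -- integrate the pointwise bound
  have hmono : ∫ p, (1 - n * (K * |ε|) * ((∑ e, |p e|) ^ 2 + α * ∑ e, |p e| + b * (c₁ + c₂))) ∂(u1MomentumLaw (ι := Edge d L) κ) ≤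
      ∫ p, min 1 (Real.exp (-ΔH p)) ∂(u1MomentumLaw (ι := Edge d L) κ) :=
    integral_mono hpoly_int hacc_int fun p =>
      ((sub_le_sub_left (hpt p) 1).trans (hacc (ΔH p)))
  -- evaluate the left-hand side with the moments of the refresh law
  have hlhs : ∫ p, (1 - n * (K * |ε|) * ((∑ e, |p e|) ^ 2 + α * ∑ e, |p e| + b * (c₁ + c₂))) ∂(u1MomentumLaw (ι := Edge d L) κ) =
      1 - n * (K * |ε|) * (∫ p, (∑ e, |p e|) ^ 2 ∂(u1MomentumLaw (ι := Edge d L) κ) +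
        α * ∫ p, ∑ e, |p e| ∂(u1MomentumLaw (ι := Edge d L) κ) + b * (c₁ + c₂)) := by
    rw [integral_sub (integrable_const _) hCq, integral_const, integral_const_mul, integral_add h8α (integrable_const _),
      integral_add h8 hαs, integral_const_mul, integral_const]
    simp only [probReal_univ, smul_eq_mul, one_mul]
  have hE2 : ∫ p, (∑ e, |p e|) ^ 2 ∂(u1MomentumLaw (ι := Edge d L) κ) ≤ (Fintype.card (Edge d L) : ℝ) ^ 2 * (1 / (2 * κ)) := by
    have h := integral_sq_sum_norm_u1MomentumLaw_le (ι := Edge d L) hκ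
    simpa only [Real.norm_eq_abs] using h
  have hE1 : ∫ p, ∑ e, |p e| ∂(u1MomentumLaw (ι := Edge d L) κ) = Fintype.card (Edge d L) * (1 / Real.sqrt (Real.pi * κ)) := by
    have h := integral_sum_norm_u1MomentumLaw (ι := Edge d L) hκ
    simpa only [Real.norm_eq_abs] using h
  have hfin : 1 - n * (K * |ε|) * ((Fintype.card (Edge d L) : ℝ) ^ 2 * (1 / (2 * κ)) +
      α * (Fintype.card (Edge d L) * (1 / Real.sqrt (Real.pi * κ))) + b * (c₁ + c₂)) ≤
      1 - n * (K * |ε|) * (∫ p, (∑ e, |p e|) ^ 2 ∂(u1MomentumLaw (ι := Edge d L) κ) +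
        α * ∫ p, ∑ e, |p e| ∂(u1MomentumLaw (ι := Edge d L) κ) + b * (c₁ + c₂)) := by
    rw [hE1]
    have hcoef : 0 ≤ (n : ℝ) * (K * |ε|) := by positivity
    nlinarith [hE2, hcoef]
  have hgoal := (hfin.trans (hlhs.symm.le)).trans hmono
  rw [hα, hb, hc₁, hc₂] at hgoal
  simpa only [hΔH, hG] using hgoal

end MeanAcceptance

end Summit.Ventures.LatticeQCDFlow.Exactness
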